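import Mathlib
import HarnessLib
import HarnessLib.Audit
import Summits.AtomisticToContinuum.Statement
import Literature.MathematicalPhysics.QuantumLattice.XYOrder
import Literature.MathematicalPhysics.QuantumManyBody.PeriodicBoseGas
import HarnessLib.Audit.Status.Attr

/-!
Route: BECStronglyRayleigh

DORMANT since 2026-08-25T02:35:37Z (reconciler: no traction for 7.3 d (last activity item-evidence-added at 2026-08-17T18:55:01Z); parked, not closed — `ledger route dormant route-AtomisticToContinuum-BECStronglyRayleigh --off` to react) — unstaffed, not closed; items shared with open routes are served there. `ledger route dormant <id> --off` reactivates.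

# Route BECStronglyRayleigh — imaginary time is a Pólya–Schur preserver — strongly Rayleigh
hard-core ground states (|Δ| ≤ 1) give Lorentz-signature coherence; BEC = coherence theorem +
pair-insertion delocalisation, RP-free

It suffices to show X = X_S ∧ X_K1 ∧ X_bridge ∧ X_bc (spine card
polya-schur-imaginary-time-strongly-rayleigh and its v2
polya-schur-preserver-strongly-rayleigh-v2; conforming successor of the retired route BECPolyaSchur
— same line, now DECIDED by
`closes : KineticLatticeBEC → LatticeToPeriodicBridge → BoundaryTransferWeak →
BoseEinsteinCondensation`). X_S (GroundStateStability =
Theorem S, hard-core form): on every finite connected graph G, every magnetisation-sector ground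
vector ψ of
−Σ_{xy∈E(G)}(S¹S¹+S²S²+ΔS³S³) + Σ_x μ_x S³_x with |Δ| ≤ 1 and arbitrary real fields μ (= hard-core
bosons, hopping J = ½ > 0 on
every edge, nearest-neighbour V = −Δ, |V| ≤ 2J) has Σ_S ψ(1_S) Π_{x∈S} z_x ≠ 0 whenever all Im z_x >
0: the amplitude measure
π ∝ Ψ₀ is strongly Rayleigh. X_K1 (InsertionFieldDelocalisation): for hard-core bosons on (ℤ/Lℤ)³
(XY ferromagnet `xyTorus 3 L 1`),
at every filling 2 ≤ N ≤ L³/2, the ω-average of L³Φ_T of the two-particle insertion field r^T_x =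
Σ_y Ψ₀(T∪{x,y}) (|T| = N−2,
R_T = Σ_x r^T_x, Φ_T = Σ_x(r^T_x)³/(R_T‖r^T‖²) + ‖r^T‖²/R_T², ω_T ∝ ‖r^T‖²) is bounded by one
constant M. The provable supports
StableImpliesPairCoherence, PairKernelSumRule, SectorGroundStatePerron, PenaltySelectsSector and the
layer-2 glue
LatticeCoherenceAssembly turn X_S ∧ X_K1 into the target KineticLatticeBEC — RP-free lattice BEC
⟨S⁺_totS⁻_tot⟩_N ≥ c·N·L³ at
EVERY filling ≤ ½ on large even 3-D tori (the LSSY2005 Ch. 11 open problem). X_bridge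
(LatticeToPeriodicBridge): KineticLatticeBEC
implies torus BEC of the dilute continuum gas for every repulsive finite-range v; X_bc
(BoundaryTransferWeak, shared item
stmt-AtomisticToContinuum-0827): torus BEC ⇒ ∃ρ₀ ∀ρ < ρ₀ HasGroundStateBEC v ρ, i.e. the conjunct.
Lean: `(∀ (Λ : Type) [Fintype Λ] [DecidableEq Λ] (G : SimpleGraph Λ) [DecidableRel G.Adj],
G.Connected → ∀ (Δ : ℝ) (μ : Λ → ℝ), |Δ| ≤ 1 → ∀ (M : ℝ) (ψ :
Literature.MathematicalPhysics.QuantumLattice.TensorIndex Λ 2 → ℂ), ψ ∈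
Literature.MathematicalPhysics.QuantumLattice.spinZSector 1 M → ψ ≠ 0 →
(Literature.MathematicalPhysics.QuantumLattice.xxzHamiltonian 1 G (-1) Δ + ∑ x : Λ, ((μ x : ℝ) : ℂ)
• Literature.MathematicalPhysics.QuantumLattice.siteSpin 1 x 2).mulVec ψ =
((Literature.MathematicalPhysics.QuantumLattice.lowestEnergyInSector 1
(Literature.MathematicalPhysics.QuantumLattice.xxzHamiltonian 1 G (-1) Δ + ∑ x : Λ, ((μ x : ℝ) : ℂ)
• Literature.MathematicalPhysics.QuantumLattice.siteSpin 1 x 2) M : ℝ) : ℂ) • ψ → ∀ z : Λ → ℂ, (∀ x,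
0 < (z x).im) → (∑ S : Finset Λ, ψ (fun x => if x ∈ S then 0 else 1) * ∏ x ∈ S, z x) ≠ 0) ∧ (∃ M :
ℝ, ∀ (L : ℕ) [NeZero L], 2 ≤ L → ∀ N : ℕ, 2 ≤ N → 2 * N ≤ L ^ 3 → ∀ ψ :
Literature.MathematicalPhysics.QuantumLattice.TensorIndex
(Literature.Probability.LatticeModels.TorusSite 3 L) 2 → ℂ, ψ ∈
Literature.MathematicalPhysics.QuantumLattice.spinZSector 1 ((N : ℝ) - (L : ℝ) ^ 3 / 2) → ψ ≠ 0 →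
(Literature.MathematicalPhysics.QuantumLattice.xyTorus 3 L 1).mulVec ψ =
((Literature.MathematicalPhysics.QuantumLattice.lowestEnergyInSector 1
(Literature.MathematicalPhysics.QuantumLattice.xyTorus 3 L 1) ((N : ℝ) - (L : ℝ) ^ 3 / 2) : ℝ) : ℂ)
• ψ → (∀ σ, 0 ≤ (ψ σ).re ∧ (ψ σ).im = 0) → let φ : Finset
(Literature.Probability.LatticeModels.TorusSite 3 L) → ℝ := fun S => (ψ (fun x => if x ∈ S then 0
else 1)).re; let r : Finset (Literature.Probability.LatticeModels.TorusSite 3 L) →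
Literature.Probability.LatticeModels.TorusSite 3 L → ℝ := fun T x => ∑ y, (if x ∉ T ∧ y ∉ T ∧ x ≠ y
then φ (insert x (insert y T)) else 0); (L : ℝ) ^ 3 * ∑ T ∈ (Finset.univ : Finset
(Literature.Probability.LatticeModels.TorusSite 3 L)).powersetCard (N - 2), ((∑ x, r T x ^ 3) / (∑
x, r T x) + (∑ x, r T x ^ 2) ^ 2 / (∑ x, r T x) ^ 2) ≤ M * ∑ T ∈ (Finset.univ : Finset
(Literature.Probability.LatticeModels.TorusSite 3 L)).powersetCard (N - 2), ∑ x, r T x ^ 2) ∧ ((∃ c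
: ℝ, 0 < c ∧ ∃ L₀ : ℕ, ∀ (L : ℕ) [NeZero L], L₀ ≤ L → Even L → ∀ N : ℕ, 1 ≤ N → 2 * N ≤ L ^ 3 → c *
N * (L : ℝ) ^ 3 ≤ ((Literature.MathematicalPhysics.QuantumLattice.xyTorus 3 L 1 + (((3 + 1) * L ^ 3
: ℕ) : ℂ) • (Literature.MathematicalPhysics.QuantumLattice.totalSpin 1 2 + ((L : ℂ) ^ 3 / 2 - (N :
ℂ)) • 1) ^ 2).groundStateFunctional (Literature.MathematicalPhysics.QuantumLattice.totalSpin 1 0 *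
Literature.MathematicalPhysics.QuantumLattice.totalSpin 1 0 +
Literature.MathematicalPhysics.QuantumLattice.totalSpin 1 1 *
Literature.MathematicalPhysics.QuantumLattice.totalSpin 1 1)).re + N - (L : ℝ) ^ 3 / 2) → ∀ v : ℝ →
ENNReal, Literature.MathematicalPhysics.QuantumManyBody.BoseGas.IsRepulsiveFiniteRange v → ∃ ρ₀ : ℝ,
0 < ρ₀ ∧ ∀ ρ : ℝ, 0 < ρ → ρ < ρ₀ → ∃ c : ℝ, 0 < c ∧ ∀ᶠ N : ℕ in Filter.atTop, ∃ δ : ENNReal, 0 < δ ∧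
∀ Ψ : Literature.MathematicalPhysics.QuantumManyBody.BoseGas.PeriodicTrialState N
(Literature.MathematicalPhysics.QuantumManyBody.BoseGas.sideLength ρ N),
Literature.MathematicalPhysics.QuantumManyBody.BoseGas.periodicEnergy v Ψ ≤
Literature.MathematicalPhysics.QuantumManyBody.BoseGas.periodicGroundStateEnergy v N
(Literature.MathematicalPhysics.QuantumManyBody.BoseGas.sideLength ρ N) + δ → ENNReal.ofReal (c * N)
≤ Literature.MathematicalPhysics.QuantumManyBody.BoseGas.condensateOccupation N
(Literature.MathematicalPhysics.QuantumManyBody.BoseGas.sideLength ρ N) Ψ.ψ) ∧ (∀ v : ℝ → ENNReal,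
Literature.MathematicalPhysics.QuantumManyBody.BoseGas.IsRepulsiveFiniteRange v → (∃ ρ₀ : ℝ, 0 < ρ₀
∧ ∀ ρ : ℝ, 0 < ρ → ρ < ρ₀ → ∃ c : ℝ, 0 < c ∧ ∀ᶠ N : ℕ in Filter.atTop, ∃ δ : ENNReal, 0 < δ ∧ ∀ Ψ :
Literature.MathematicalPhysics.QuantumManyBody.BoseGas.PeriodicTrialState N
(Literature.MathematicalPhysics.QuantumManyBody.BoseGas.sideLength ρ N),
Literature.MathematicalPhysics.QuantumManyBody.BoseGas.periodicEnergy v Ψ ≤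
Literature.MathematicalPhysics.QuantumManyBody.BoseGas.periodicGroundStateEnergy v N
(Literature.MathematicalPhysics.QuantumManyBody.BoseGas.sideLength ρ N) + δ → ENNReal.ofReal (c * N)
≤ Literature.MathematicalPhysics.QuantumManyBody.BoseGas.condensateOccupation N
(Literature.MathematicalPhysics.QuantumManyBody.BoseGas.sideLength ρ N) Ψ.ψ) → ∃ ρ₀ : ℝ, 0 < ρ₀ ∧ ∀
ρ : ℝ, 0 < ρ → ρ < ρ₀ → Literature.MathematicalPhysics.QuantumManyBody.BoseGas.HasGroundStateBEC v
ρ)`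

## Assembly
Layer 1 is pure logic and is the deciding theorem, sorry-free in Sketch.lean and filed as glue.lean:
`closes (hK : KineticLatticeBEC) (hB : LatticeToPeriodicBridge) (hW : BoundaryTransferWeak) :
BoseEinsteinCondensation :=
fun v hv => hW v hv (hB hK v hv)` — the antecedent of LatticeToPeriodicBridge is KineticLatticeBEC
verbatim and the conjunct
`BoseEinsteinCondensation` unfolds to `∀ v, IsRepulsiveFiniteRange v → ∃ρ₀ > 0, ∀ρ ∈ (0,ρ₀),
HasGroundStateBEC v ρ`. Layer 2 is the
finite-dimensional support LatticeCoherenceAssembly (cruxes 2–3 + supports ⇒ the target), whence a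
prover closes KineticLatticeBEC in
one line once its antecedents land.

Rationale: WHY THIS LINE. Reflection positivity says "each Trotter slice of e^{−βH} is reflection positive";
this line says "each Trotter BOND of e^{−τH} is a
Pólya–Schur / Borcea–Brändén stability preserver": the bond factor e^{τ[J(a†_xa_y+h.c.) − Vn_xn_y]}
acts on multi-affine polynomials
with symbol G = κz_xz_y + z_x(cw_y + sw_x) + z_y(sw_y + cw_x) + w_xw_y (c = cosh Jτ, s = sinh Jτ, κ
= e^{−Vτ}) whose Brändén–Rayleigh
differences are PSD on ℝ⁴ exactly for e^{−2Jτ} ≤ κ ≤ e^{2Jτ} ⟺ |V| ≤ 2J (BondSymbolRayleigh;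
Branden2007 Thm 5.6, BorceaBranden2009
Thm 1.1), so Trotter (tree `tendsto_lieTrotter`) + multivariate Hurwitz + Perron–Frobenius (tree
`perronFrobenius_groundState_pos`,
`TokenSliding`) make every sector ground state strongly Rayleigh — the only instance in print is the
Markov endpoint V = −2J (SSEP
preserves strong Rayleigh, BorceaBrandenLiggett2007 Thm 5.2), and the window closes exactly at the
two Heisenberg points. Imported
area: the geometry of polynomials / negative dependence (BorceaBrandenLiggett2007,
BorceaBranden2009, Branden2007, arXiv:1210.3231)
and its Hodge–Riemann face (BrandenHuh2019 Prop 1.2, Lemma 1.5): zero-freeness becomes RANK-ONE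
DOMINANCE of every conditional pair
kernel K_T(x,y) = Ψ₀(T∪{x,y}) (exactly one positive eigenvalue, reverse Cauchy–Schwarz), an exact
N-uniform no-fragmentation
theorem, and the identity Σ_T‖K_T1‖² = (N−1)⟨S⁺_totS⁻_tot⟩ (PairKernelSumRule) gives f₀ ≥
1/E_ω[L³Φ_T]: BEC splits into COHERENCE
(theorem) and DELOCALISATION of the pair-insertion field (crux K1, the only place dimension enters;
in d = 1 Theorem S still holds —
Tonks = |sin| circulant — while M ≍ N^c, consistent with PitaevskiiStringariOneDimension). What it
does that prior lines do not:
KLS1988PRL / AizenmanEtAl2004 need reflection positivity, hence half filling (barrier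
HalfFillingReflectionPositivity and
`rp_oddCharge_eq_zero`); BECFillingMonotone-type anchors leave half filling only through unproved
sector-comparison inequalities;
swap/Palm lines reduce BEC to flatness of ONE-particle insertion amplitudes with no structural
control of coherence (the one BEC entry
of the negatives index, BECSwapAffinity.SwapJensen, is a quantifier slip in that family and is not
used here); here coherence is a
theorem at every filling, on every graph, with arbitrary on-site disorder, and what remains is a
moment bound on a positive field
plus the continuum bridges shared with the rest of the sub-problem.

RANKED CRUXES. #0 KineticLatticeBEC (target) — RP-free lattice BEC at every filling ≤ ½ in d = 3:
there are c > 0 and L₀ such that on every even torus (ℤ/Lℤ)³, L ≥ L₀, for all 1 ≤ N ≤ L³/2, the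
tracial ground state of the penalised XY Hamiltonian xyTorus 3 L 1 + 4L³(S³_tot + L³/2 − N)² (= the
sector-N ground state of hard-core bosons, PenaltySelectsSector) has ⟨S⁺_totS⁻_tot⟩ =
⟨(S¹_tot)²+(S²_tot)²⟩ + N − L³/2 ≥ c·N·L³, i.e. λ_max(γ_N) = zero-mode occupation ≥ cN. It is
UniformLatticeBEC at d = 3 and the exact antecedent of LatticeToPeriodicBridge; within this route it
follows from GroundStateStability + InsertionFieldDelocalisation + the supports by
LatticeCoherenceAssembly with c = 1/max(M,1), L₀ = 2. (why it might fail: it is LSSY's open "BEC at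
fillings ≠ ½"; via this route it fails only if InsertionFieldDelocalisation does (M = ∞ at some
filling ≤ ½) — the coherence half is a theorem; a direct proof by any other means also closes it.)
[LSSY2005, KLS1988PRL, AizenmanEtAl2004, Toth1991, Ueltschi2013, BorceaBrandenLiggett2007]
#2 GroundStateStability (crux) — Theorem S of the card (hard-core form; the new theorem this line
rests on — filed FIRST): for every finite connected graph G on Λ, every |Δ| ≤ 1, every field μ : Λ →
ℝ and every magnetisation sector M, a sector ground vector ψ (ψ in the S³_tot = M eigenspace, ψ ≠ 0,
Hψ = E_min(sector)ψ) of H = xxzHamiltonian 1 G (−1) Δ + Σ_x μ_x S³_x satisfies Σ_S ψ(1_S) Π_{x∈S}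
z_x ≠ 0 whenever all Im z_x > 0 (occupied = spin up = Fin-index 0; by Perron–Frobenius on the token
graph ψ is positive up to a phase and unique, so this is real stability = strongly Rayleigh). Proof
plan (cone repair 2026-08-15: every input below is PROVED in the tree; the unproved named fact
`Literature.Combinatorics.StablePolynomials.Branden2007_multiAffine_rayleighDiff_nonneg_iff_realStable`
= Brändén2007 Thm 5.6 is NOT needed): the bond factor e^{τ(S¹_xS¹_y+S²_xS²_y+ΔS³_xS³_y)} is a kernel
operator on coefficient families whose Borcea–Brändén symbol factorises as
G_bond(z_x,z_y,w_x,w_y)·Π_{i≠x,y}(z_i+w_i), G_bond = w_xw_y + (c z_x + s z_y)w_y + (s z_x + c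
z_y)w_x + κ z_xz_y = ½uᵀQu (u = (z_x,z_y,w_x,w_y), c = cosh t, s = sinh t, t = Jτ, κ = e^{−Vτ} up to
positive rescaling of variables, Q = [[0,κ,s,c],[κ,0,c,s],[s,c,0,1],[c,s,1,0]]); under x↔y, Q =
[[κ,c+s],[c+s,1]] ⊕ [[−κ,s−c],[s−c,−1]] with determinants κ−e^{2t} and κ−e^{−2t}, so Q has exactly
ONE positive eigenvalue iff e^{−2t} ≤ κ ≤ e^{2t} ⟺ |V| ≤ 2J ⟺ |Δ| ≤ 1 (the BondSymbolRayleigh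
window; that support stays the cheapest falsifier); a nonzero entrywise-nonnegative symmetric Q with
one positive eigenvalue gives a real-stable quadratic form (reverse Cauchy–Schwarz B(y,v)² ≥
q(y)q(v) for y > 0, whence q(v+iy) = q(v) − q(y) + 2iB(y,v) ≠ 0; BrandenHuh2019 degree 2,
elementary), products with the stable z_i+w_i are stable, and Borcea–Brändén Lemma 2.2 in kernel
form — PROVED: `Literature.Combinatorics.StablePolynomials.multiAffine_kernel_stable_or_zero`
(KernelForm.lean), `multiAffine_stabilityPreserver_sufficiency` /
`BorceaBranden2009_multiAffine_stabilityPreserver_iff_holds` (BasicProofs.lean) — makes each bond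
factor map H^Λ-zero-free coefficient families to zero-free-or-0 ones with NO freezing of the other
|Λ|−2 variables; site factors e^{−τμ_xS³_x} are positive scalings of z_x; Lie–Trotter over bonds and
sites (tree `tendsto_lieTrotter`, m-term version by the standard O(1/n²) estimate), multivariate
Hurwitz along complex lines (tree `eq_zero_or_isUpperHalfPlaneStable_of_mem_closure`, Limits.lean),
e_N = Σ_{|S|=N} z^S is stable (tree `isUpperHalfPlaneStable_esymm`), and the τ → ∞ limit
e^{−τ(H−E_min)}e_N → ⟨ψ,1⟩ψ is nonzero by Perron positivity (tree
`perronFrobenius_groundState_pos/unique`), hence stable. [difficulty: L] (why it might fail: needs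
the SUFFICIENCY half of the Borcea–Brändén symbol criterion for the 4×4 bond operator with the other
|Λ|−2 variables frozen in H (complex coefficients); a slip there or at |Δ| = 1, where two Rayleigh
differences degenerate to cs(w_x+w_y)², leaves a zero in H^Λ (ED ≤ 16 sites: none).)
[BorceaBranden2009, BorceaBrandenLiggett2007, Branden2007, arXiv:1210.3231, Tasaki2020]
#3 InsertionFieldDelocalisation (crux) — card item K1, typed for d = 3, Δ = 0, all fillings ≤ ½:
there is M such that for every L ≥ 2, every 2 ≤ N ≤ L³/2 and every entrywise real-nonnegative
sector-N ground vector ψ of xyTorus 3 L 1 (sector S³_tot = N − L³/2), with φ(S) = Re ψ(1_S) and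
r^T_x = Σ_y [x,y ∉ T, x ≠ y] φ(T∪{x,y}) for |T| = N−2: L³ · Σ_T [ Σ_x (r^T_x)³ / Σ_x r^T_x + (Σ_x
(r^T_x)²)² / (Σ_x r^T_x)² ] ≤ M · Σ_T Σ_x (r^T_x)² — the ω-average (ω_T ∝ ‖r^T‖²) of L³Φ_T is ≤ M
(cross-multiplied, so Lean's x/0 = 0 matches r^T ≡ 0). For a flat insertion field L³Φ_T =
2L³/(L³−N+2) ∈ [2,4]; for each fixed L the inequality holds with M = 2L³ (r ≥ 0), so only the
thermodynamic limit is at stake. [deps: GroundStateStability] [difficulty: XL] (why it might fail: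
lattice BEC in disguise (E_ω[L³Φ_T] ≥ 1/f₀ always): a heavy upper tail of log r^T under ω, or loss
of spatial self-averaging of Σ_x(r^T_x)^k at some filling ≤ ½, makes M = ∞; in d = 1 Theorem S holds
yet M ≍ N^c; no tool beyond negative association of π so far.) [ReattoChester1967, LSSY2005,
BorceaBrandenLiggett2007, Toth1991, KLS1988PRL]
#4 LatticeToPeriodicBridge (crux) — KineticLatticeBEC (uniform RP-free BEC of hard-core bosons on
even 3-D tori at all fillings ≤ ½, written out verbatim as antecedent — the shared signature of
stmt-AtomisticToContinuum-5008) implies PeriodicBEC: for every repulsive finite-range v there is ρ₀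
> 0 such that for 0 < ρ < ρ₀ there is c > 0 with, for all large N, some δ > 0 such that every
δ-near-minimiser of the periodic N-body energy on the torus of side (N/ρ)^{1/3} has constant-mode
occupation ≥ cN. Intended mechanisms (layer 2, not filed): (i) optical-lattice depth homotopy at
fixed spacing b = 2R₀(v), filling ν = ρb³ small, deep end = dilute hard-core lattice gas; (ii) a
Josephson-array reduction — condensates of Fournais/Junge boxes (proved in tree:
Fournais2020_condensation) coupled through faces form a soft-core Bose–Hubbard array, which is
INSIDE Theorem S's class (hopping = nonnegative substitution, U ≥ 0 a Pólya–Schur multiplier), so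
global coherence would again be Lorentz signature + delocalisation one scale up. [deps:
KineticLatticeBEC] [difficulty: open-problem] (why it might fail: a bare implication between two
open statements — as hard as PeriodicBEC unless a comparison sign (condensate monotone in lattice
depth) or a box-array reduction into Theorem S's soft-core class is found; universality of an ORDER
PARAMETER (not an energy) across the tight-binding limit is unproved.) [AizenmanEtAl2004, LSSY2005,
arXiv:2602.16566, Fournais2020, Junge2026]
#5 BoundaryTransferWeak (crux) — shared item stmt-AtomisticToContinuum-0827 (routes
BECGroundStateSOS, BECMeanFieldControl, …), verbatim: for each repulsive finite-range v,
PeriodicBEC(v) implies ∃ρ₀ > 0 ∀ρ ∈ (0, ρ₀), HasGroundStateBEC v ρ (Dirichlet ground state, λ_max(γ)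
≥ cN via condensateNumber). Expected proof: Neumann bracketing / Neumann localisation of interior
sub-boxes (−Δ_Dir ≥ ⊕−Δ_Neu, v ≥ 0; Junge2026) plus a mode-free criterion λ_max ≥ tr γ²/N; only the
ENERGY analogue is in print (LSSY2005 Ch. 2 after (2.8)). [deps: LatticeToPeriodicBridge]
[difficulty: L] (why it might fail: PeriodicBEC is ground-state-only at the box (N/ρ)^{1/3}; the
Dirichlet ground state lies a wall term ≫ δ above E₀^per and interior restrictions are neither
periodic nor of sharp N; BEC can be boundary-condition sensitive (Robinson1976).) [LSSY2005,
Robinson1976, PenroseOnsager1956, Junge2026]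
#9 StableImpliesPairCoherence (support) — geometry-of-polynomials glue (BrandenHuh2019 Prop 1.2,
Lemma 1.5; in fact elementary): for a finite set Λ, N ≥ 2 and φ : Finset Λ → ℝ≥0 supported on N-sets
whose generating polynomial Σ_S φ(S) z^S has no zero in H^Λ, with r^T_x = Σ_y [x,y ∉ T, x ≠ y]
φ(T∪{x,y}): N(N−1) Σ_S φ(S)² ≤ Σ_{|T|=N−2} [ Σ_x (r^T_x)³/R_T + ‖r^T‖⁴/R_T² ]. Proof: ∂^T p = ½
zᵀK_T z is stable (derivatives and Hurwitz) with K_T ≥ 0 and zero diagonal, hence Lorentzian: (1ᵀK_T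
v)² ≥ R_T · vᵀK_T v for real v (reverse Cauchy–Schwarz); v = e_x + e_y gives K_T(x,y) ≤
(r_x+r_y)²/(2R_T), v = r gives rᵀK_T r ≤ ‖r‖⁴/R_T; sum K_T² ≤ K_T(r_x+r_y)²/(2R_T) over x ≠ y and
over T, using Σ_T‖K_T‖_F² = N(N−1)Σ_Sφ(S)² (x/0 = 0 matches K_T = 0). Checked by hand on Λ =
{1,2,3}, N = 2, 3 (equality for z₁z₂z₃, 6 ≤ 8 for e₂). [difficulty: M] [BrandenHuh2019,
BorceaBrandenLiggett2007, arXiv:1210.3231]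
#9 PairKernelSumRule (support) — the finite identity behind "n₀ = pair-insertion coherence": for φ
supported on N-sets (N ≥ 2) and r^T as above, Σ_{|T|=N−2} Σ_x (r^T_x)² = (N−1) Σ_{x,y} γ(x,y), where
γ(x,x) = Σ_{S∋x} φ(S)² and γ(x,y) = Σ_{|T'|=N−1, x,y∉T'} φ(T'∪{x}) φ(T'∪{y}) for x ≠ y (= ⟨ψ, S⁺_x
S⁻_y ψ⟩ for the spin-½ vector ψ(1_S) = φ(S)); pure double counting ((T,x) ↦ T∪{x} is (N−1)-to-1).
Checked by hand on Λ = {1,2,3}, N = 2 (12 = 12). [difficulty: provable-now] [PenroseOnsager1956,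
Toth1991]
#9 SectorGroundStatePerron (support) — Perron–Frobenius in a magnetisation sector of the XY torus:
for d ≥ 1, L ≥ 2 and N ≤ L^d the sector S³_tot = N − L^d/2 of xyTorus d L 1 contains a nonzero,
entrywise real-nonnegative vector ψ with Hψ = E_min(sector)ψ, and every sector vector with that
eigenvalue is a complex multiple of ψ (off-diagonal matrix elements −½ ≤ 0; the N-token graph of the
connected torus graph is connected — tree `TokenSliding.exists_slide_out`,
`perronFrobenius_groundState_pos/unique`). [difficulty: provable-now] [Tasaki2020, KLS1988PRL,
doi:10.1007/s00373-011-1055-9]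
#9 PenaltySelectsSector (support) — shared item stmt-AtomisticToContinuum-5011, verbatim (the
encoding lemma linking sector ground vectors to the target's penalised Hamiltonian): for d ≥ 1, L ≥
1, N ≤ L^d every ground vector of xyTorus d L 1 + (d+1)L^d·(S³_tot + (L^d/2 − N)·1)² lies in the
sector of N bosons (the penalty (d+1)L^d exceeds the spectral width ≤ 2‖H‖ ≤ d·L^d of the XY
Hamiltonian, each bond S¹S¹+S²S² having norm ½, and the sector is non-empty). [difficulty:
provable-now] [Tasaki2020, KLS1988PRL]
#9 BondSymbolRayleigh (support) — the cheapest falsifier, formalised: for t > 0 (= Jτ) and κ > 0 (=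
e^{−Vτ}), the three Brändén–Rayleigh differences of the bond symbol — cosh t·sinh t(a²+b²) + (cosh²t
+ sinh²t − κ)ab, κ cosh t·a² + (κ+1)ab + cosh t·b², κ sinh t·a² + (κ−1)ab + sinh t·b² — are all
nonnegative on ℝ² iff e^{−2t} ≤ κ ≤ e^{2t} (⟺ |V| ≤ 2J, "bondwise kinetic domination";
discriminants: (c−s)² ≤ κ ≤ (c+s)², cosh t ≥ cosh(½log κ), sinh t ≥ |sinh(½log κ)| — each of the
three alone already pins the same window). [difficulty: provable-now] [Branden2007,
BorceaBranden2009, BorceaBrandenLiggett2007]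
#9 LatticeCoherenceAssembly (support) — the layer-2 glue (finite-dimensional, est. 600–1000 lines,
provable now from its antecedents): GroundStateStability → StableImpliesPairCoherence →
InsertionFieldDelocalisation → PairKernelSumRule → SectorGroundStatePerron → PenaltySelectsSector →
KineticLatticeBEC. Proof: for L ≥ 2 and 2 ≤ N ≤ L³/2 take the Perron vector ψ of the sector
(SectorGroundStatePerron); GroundStateStability with G = torusGraph 3 L, Δ = 0, μ = 0 (the field sum
vanishes by `simp`) gives zero-freeness of Σ_S φ(S) z^S, φ = Re ψ(1_·) ≥ 0 supported on N-sets;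
StableImpliesPairCoherence and InsertionFieldDelocalisation give N(N−1)L³Σφ² ≤ L³Σ_T‖r^T‖²Φ_T ≤ M
Σ_T‖r^T‖² = M(N−1)Σ_{x,y}γ(x,y) (PairKernelSumRule), and Σ_{x,y}γ(x,y) = ⟨ψ, S⁺_totS⁻_tot ψ⟩ (spin-½
matrix elements of S⁺_xS⁻_y are 1), so ⟨S⁺_totS⁻_tot⟩_ψ ≥ N·L³‖ψ‖²/max(M,1); PenaltySelectsSector +
uniqueness identify the ground space of the penalised Hamiltonian with ℂψ, whose
groundStateFunctional is the pure state of ψ, and ⟨S⁺_totS⁻_tot⟩ = ⟨(S¹_tot)²+(S²_tot)²⟩ + ⟨S³_tot⟩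
with S³_tot = N − L³/2; N = 1 is one free particle (⟨S⁺_totS⁻_tot⟩ = L³). Hence KineticLatticeBEC
with c = min(1, 1/max(M,1)), L₀ = 2. [difficulty: L] [LSSY2005, BrandenHuh2019, Tasaki2020]

TWO-LAYER PLAN. Foreseen glued splits (none filed now; k ≤ 3, depth 1): GroundStateStability ⇐
BondSymbolLorentzian (the 4×4 bond-symbol matrix Q above has exactly one positive eigenvalue iff
e^{−2t} ≤ κ ≤ e^{2t}, so by the PROVED kernel-form Borcea–Brändén Lemma 2.2 each bond factor
preserves H^Λ-zero-freeness-or-0)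
→ SemigroupPreservesStability (Lie–Trotter over bonds and sites, multivariate Hurwitz) →
GroundStateStability (τ → ∞, Perron positivity
of ⟨ψ, e_N⟩); InsertionFieldDelocalisation ⇐ InsertionFieldExpMoments (uniform bound on the
ω-weighted third moment of r^T_x / mean)
→ SpatialSelfAveraging (law of large numbers for Σ_x(r^T_x)^k across the torus from negative
association of the strongly Rayleigh π,
BorceaBrandenLiggett2007 Thm 4.9, and the one-particle-at-a-time coupling π_N ≼ π_{N+1}, ibid. Thm
4.19) → InsertionFieldDelocalisation;
LatticeToPeriodicBridge ⇐ either DepthMonotone → TightBindingLimit (optical-lattice homotopy, shared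
with the cards
optical-lattice-depth-homotopy / kls-anchor-filling-monotone) or FournaisBoxArray →
SoftCoreStability → ArrayDelocalisation (Josephson
array of Fournais2020/Junge2026 boxes, inside Theorem S's soft-core class). Helper lemmas
(token-graph connectivity, S⁺S⁻ matrix
elements, e_N stable, Hurwitz along lines, multi-factor Lie–Trotter) ride with `--supports`, never
as items.

KILL CRITERIA. A certified zero in H^Λ of the generating polynomial of one exact-diagonalisation
sector ground state with |Δ| ≤ 1 (equivalently one
conditional pair kernel K_T with two positive eigenvalues, or one non-real root on a real line x +
t·e, e > 0), persisting in exact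
rational arithmetic, refutes GroundStateStability and closes the route
`refuted:GroundStateStability` — the line IS this theorem (a
refutation confined to μ ≠ 0 or |Δ| = 1 forces instead a 1:1 restatement to the XY-torus case the
assembly uses).
InsertionFieldDelocalisation refuted at intermediate filling ⇒ pivot (route edit --restate) to the
small-filling form ∃ν₀ ∀N ≤ ν₀L³ with
a small-filling bridge; refuted at small filling in d = 3 ⇒ close (the Lorentz-signature reading of
BEC would be vacuous where it
matters). StableImpliesPairCoherence / PairKernelSumRule / SectorGroundStatePerron /
PenaltySelectsSector / BondSymbolRayleigh /
LatticeCoherenceAssembly refuted ⇒ transcription slip, restate 1:1. LatticeToPeriodicBridge /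
BoundaryTransferWeak share the fate of the
other torus routes (pivot to a Dirichlet-lattice or Neumann-localisation bridge). PeriodicBEC or the
conjunct proved elsewhere moots ranks
4–5 but not the lattice target; KineticLatticeBEC proved by any route moots rank 3, while rank 2
stays wanted as a Literature-grade theorem.

NOT DECOMPOSED YET. The soft-core Bose–Hubbard version of Theorem S (hopping = nonnegative
substitution z ↦ e^{τJA}z, (e^{−Uτk(k−1)/2})_k a Pólya–Schur
multiplier sequence by Laguerre; needs a truncation-free bosonic Fock space in Lean);
bond-disordered couplings J_xy (only field disorder
μ_x is typed); the consequences not used by the assembly — CNA+/negative association and ULC block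
counts of π, S_amp(k) ≤ 1, the
one-particle-at-a-time stochastic domination π_N ≼ π_{N+1} (v2 card, (e)), and the empirical
conjecture P that |Ψ₀|² itself is stable for
homogeneous pure hopping; the d = 2 and general-graph versions of K1; the card's continuum
alternative K2(i) (coarse-grained Lorentzian
conjecture for −Δ+Σv, needing a cell-occupation generating polynomial of the continuum ground state
— a definition request deferred until
rank 2 lands); the constants M (best possible ≈ 4 near half filling) and c = 1/M; every layer-2
child above.

CHEAPEST FALSIFIER. (1) BondSymbolRayleigh by hand: discriminants give (cosh t − sinh t)² ≤ κ ≤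
(cosh t + sinh t)², i.e. the window e^{∓2t} — re-derived in
this seat (agrees with the card's sympy job j000120 and the refuter re-derivations of triage-18 /
audit-23). (2) Exact diagonalisation,
minutes: sector ground states of the 4×4 torus (N = 2…8), 2×2×4 and 3×3×3 tori, rings n ≤ 12, Δ ∈
{0, ±0.5, ±1} with random fields
|μ_x| ≤ 3: test Σ_Sψ(S)Πz_x on 10⁴ random real lines x + t·e (e > 0) for non-real roots and every
K_T for a second positive eigenvalue;
Δ = ±1.05 must FAIL (card: 0 violations in 90 ground states / 5·10⁴ kernels at |V| ≤ 2J; λ₂/λ₁ =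
1.1e−3…5.6e−3 at V = 2.1J; jobs
j000120, j000230, j000396, j000422). (3) For K1 the same ED gives E_ω[L³Φ_T] sector by sector: ≈ 2–4
on 3-D tori, growing with n on
rings at fixed filling. Not re-run here (plancard seat, compute-free hub); inherited from the card
with job ids; the two finite supports
were hand-checked on 3-site examples in this seat.

NUMBERS. Window |V| ≤ 2J ⟺ |Δ| ≤ 1 (ferro-XY sign), sharp: λ₂/λ₁(K_T) = 1.1e−3…5.6e−3 at V = 2.1J,
0.1–0.37 at V = 4–8J (card, j000230). Flat-field
value L³Φ_T = 2L³/(L³−N+2) ∈ [2, 4] for 2 ≤ N ≤ L³/2, so the best constant this route can deliver is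
c = 1/M ≤ ½ at small filling and
≤ ¼ near half filling; necessary M ≥ 1/f₀ (f₀ = condensate fraction); trivially M(L) ≤ 2L³ at fixed
L. Comparison points: Toth1991
λ_max(γ_N) ≤ N(L³−N+1)/L³; KLS/ALSSY anchor at half filling f ≥ 2 × 0.032 (LSSY2005 (11.26)); free
lattice gas f ≡ 1. Exact anchors of
Theorem S: N = 2 on ℤ^d, d ≥ 3, K = f_∞(J − G/G(0)) Lorentzian by inspection; d = 1 Tonks, K_T
congruent to the circulant |sin(πr/n)|
with Fourier coefficients −4/(π(4k²−1)) < 0. Items at open: 12 (1 target, 4 cruxes, 6 supports, 1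
assembly).

DEFINITION REQUESTS. None required at open: every item is typed over existing declarations
(`xxzHamiltonian`, `spinZSector`, `lowestEnergyInSector`,
`siteSpin`, `xyTorus`, `totalSpin`, `Matrix.groundStateFunctional`, `Matrix.groundSpace`,
`TorusSite`, `PeriodicTrialState`,
`periodicEnergy`, `periodicGroundStateEnergy`, `condensateOccupation`, `IsRepulsiveFiniteRange`,
`HasGroundStateBEC` — all
`lean search`ed; Sketch.lean rc 0 incl. `closes`), with the half-plane predicate written inline.
WANTED for the provers of ranks 2 and 9
(filed after open as a definition request for GroundStateStability): a Literature home
`Literature/Combinatorics/StablePolynomials`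
(`IsUpperHalfPlaneStable` for MvPolynomial / function form, closure under positive scaling,
specialisation and ∂ via Hurwitz, the line
criterion for real stability, Branden2007 Thm 5.6, and the named facts BorceaBranden2009 Thm 1.1 and
BrandenHuh2019 Prop 1.2 /
Lemma 1.5); the bib entry Branden2007 already carries that topic keyword.

Novelty: Searches (2026-08-15, this seat): `lit search --hybrid "strongly Rayleigh ground state hard-core
bosons stable polynomial"` (12 rows,
all Monte-Carlo / unrelated books); `lit galaxy search "strongly Rayleigh" --star all` (32 rows:
panama 8 irrelevant, pdf 22 = Gao–Wagner
arXiv:1411.7735, BrandenHuh2019, Pemantle arXiv:1210.3231, DPP / Kadison–Singer / TSP notes — no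
physics, crabby 2); zbMATH "Borcea
Branden Liggett negative dependence geometry of polynomials" (4: BorceaBrandenLiggett2007, Liggett
arXiv:0710.3606, Liggett–Vandenberg-Rodes
arXiv:1009.4899, arXiv:2404.09680); zbMATH "strongly Rayleigh measure quantum ground state" (0),
"symmetric exclusion process strong
Rayleigh stability preserver" (0), "Lorentzian polynomials statistical mechanics partition function"
(0), "Lee-Yang Heisenberg
ferromagnet" (1, irrelevant), "half-plane property quantum" (15, none relevant); crossref "negative
dependence bosons" (12, none);
arXiv / OpenAlex / S2 APIs rate-limited (429) in this seat — recorded; `lit frontier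
AtomisticToContinuum --since 2022` (30 rows; condensation
side: arXiv:2510.20493, Junge2026 = arXiv:2603.20776, arXiv:2602.16566 — none touches stability);
plus the card's sweep (zbMATH/Crossref
×10, galaxy ×3) and the refuter audits triage-18 / audit-23 (arXiv ×4, zbMATH, crossref, galaxy pdf
intelligent: "no source states
stability of XX/XXZ/Bose–Hubbard ground-state amplitudes"), inherited with ids.
Nearest prior art found: BorceaBrandenLiggett2007 (arXiv:0707.2340) Thm 5  [refs: 10.1103/physrevlett.114.060601, 1411.7735, 1210.3231, 0710.3606, 1009.4899, 2404.09680, 2510.20493, 2603.20776, 2602.16566, 0707.2340, doi:10.1103/physrevlett.114.060601, BrandenHuh2019, BorceaBrandenLiggett2007, Junge2026, BorceaBranden2009, Branden2007, SuzukiFisher1971, Ueltschi2013]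

Barriers (technique_class: geometry-of-polynomials, negative-dependence): - technique_class: geometry-of-polynomials, negative-dependence
- Literature.Barriers.AtomisticToContinuum.HalfFillingReflectionPositivity: evaded by construction —
no reflection plane, no Gaussian domination, no particle–hole symmetry: the positivity is
zero-freeness of Σ_SΨ₀(S)z^S on H^Λ, certified bondwise by the Pólya–Schur / Borcea–Brändén
classification, needing only hopping J_xy > 0 and |V_xy| ≤ 2J_xy; it holds in every sector (every
filling), on every finite connected graph and with arbitrary on-site fields (the ALSSY staggered
field λ(−1)^x is an instance at every λ), and still outputs T = 0 correlation inequalities (reverse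
Cauchy–Schwarz for every K_T).
- Literature.Barriers.AtomisticToContinuum.HalfFillingReflectionPositivityNarrow: its conjunct
`rp_oddCharge_eq_zero` (an RP state has ⟨N⟩ = |Λ|/2) is exactly what this line never invokes —
sectors are reached by Perron–Frobenius + stability, not by RP.
- Literature.Barriers.AtomisticToContinuum.KineticGapLengthScales: evaded on the lattice half — no
gap, Poincaré or L² factor enters; τ → ∞ at fixed volume only identifies Ψ₀ and stability is closed
under limits (Hurwitz); conceded that the continuum items (ranks 4–5, Neumann-localisation class)
inherit whatever this barrier says about PeriodicBEC.
- Literature.Barriers.AtomisticToContinuum.EnergyAsymptoticsWithoutCondensation: evaded — no energy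
asymptotics anywhere; the input is the algebraic structure of e^{−τH}, the output an order-parameter
inequality.
- Literat

History (route lifecycle, newest last):
- 2026-08-15T21:15:39Z · rev 10: restated Assembly (stmt-AtomisticToContinuum-9681) — route-repair(ground-failed): the only BLOCKING flag was Assembly (stmt-AtomisticToContinuum-9681, kind assembly) = KineticLatticeBEC → LatticeToPeriodicBridge → (planner-rground-AtomisticToContinuum-BECStrongl-59c85534-0)
- 2026-08-25T02:35:37Z · DORMANT — reconciler: no traction for 7.3 d (last activity item-evidence-added at 2026-08-17T18:55:01Z); parked, not closed — `ledger route dormant route-AtomisticToConti (operator:999:3352979)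

sub-problem: BoseEinsteinCondensation · status: dormant · opened planner-plancard-AtomisticToContinuum-BoseEin-f536eab7-0 2026-08-15T14:09:31Z · rev 10 · ledger route-AtomisticToContinuum-BECStronglyRayleigh
GENERATED by the gate from the ledger (D-0016/17). Provers cite these decls: `theorem foo : Summit.AtomisticToContinuum.BoseEinsteinCondensation.Theses.BECStronglyRayleigh.<Decl> := …` in Summits/AtomisticToContinuum/BoseEinsteinCondensation/Theorems/<Name>.lean.
-/

namespace Summit.AtomisticToContinuum.BoseEinsteinCondensation.Theses.BECStronglyRayleigh

open scoped BigOperators Topology Manifold Classical MeasureTheory ProbabilityTheory Matrix InnerProductSpace ComplexConjugate ContinuousMap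
open Filter Set Function TopologicalSpace MeasureTheory

attribute [summit_statement] _root_.BoseEinsteinCondensation

/-- item stmt-AtomisticToContinuum-9671 · crux (kind.auto-crux: conjecture-grade) · rank 0 · open · by planner
why it might fail: it is LSSY's open "BEC at fillings ≠ ½"; via this route it fails only if InsertionFieldDelocalisation does (M = ∞ at some filling ≤ ½) — the coherence half is a theorem; a direct proof by any other means also closes it.
sources: LSSY2005, KLS1988PRL, AizenmanEtAl2004, Toth1991, Ueltschi2013, BorceaBrandenLiggett2007
[target] RP-free lattice BEC at every filling ≤ ½ in d = 3: there are c > 0 and L₀ such that on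
every even torus (ℤ/Lℤ)³, L ≥ L₀, for all 1 ≤ N ≤ L³/2, the tracial ground state of the penalised XY
Hamiltonian xyTorus 3 L 1 + 4L³(S³_tot + L³/2 − N)² (= the sector-N ground state of hard-core
bosons, PenaltySelectsSector) has ⟨S⁺_totS⁻_tot⟩ = ⟨(S¹_tot)²+(S²_tot)²⟩ + N − L³/2 ≥ c·N·L³, i.e.
λ_max(γ_N) = zero-mode occupation ≥ cN. It is UniformLatticeBEC at d = 3 and the exact antecedent of
LatticeToPeriodicBridge; within this route it follows from GroundStateStability +
InsertionFieldDelocalisation + the supports by LatticeCoherenceAssembly with c = 1/max(M,1), L₀ = 2. -/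
@[route_item "route-AtomisticToContinuum-BECStronglyRayleigh", crux]
def KineticLatticeBEC : Prop :=
  ∃ c : ℝ, 0 < c ∧ ∃ L₀ : ℕ, ∀ (L : ℕ) [NeZero L], L₀ ≤ L → Even L → ∀ N : ℕ, 1 ≤ N → 2 * N ≤ L ^ 3 → c * N * (L : ℝ) ^ 3 ≤ ((Literature.MathematicalPhysics.QuantumLattice.xyTorus 3 L 1 + (((3 + 1) * L ^ 3 : ℕ) : ℂ) • (Literature.MathematicalPhysics.QuantumLattice.totalSpin 1 2 + ((L : ℂ) ^ 3 / 2 - (N : ℂ)) • 1) ^ 2).groundStateFunctional (Literature.MathematicalPhysics.QuantumLattice.totalSpin 1 0 * Literature.MathematicalPhysics.QuantumLattice.totalSpin 1 0 + Literature.MathematicalPhysics.QuantumLattice.totalSpin 1 1 * Literature.MathematicalPhysics.QuantumLattice.totalSpin 1 1)).re + N - (L : ℝ) ^ 3 / 2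

/-- item stmt-AtomisticToContinuum-9672 · crux · rank 2 · closed · proved by Summit.AtomisticToContinuum.BoseEinsteinCondensation.Theorems.GroundStateStability_proof @ 091ebf466cf7 (prover) · by planner
why it might fail: needs the SUFFICIENCY half of the Borcea–Brändén symbol criterion for the 4×4 bond operator with the other |Λ|−2 variables frozen in H (complex coefficients); a slip there or at |Δ| = 1, where two Rayleigh differences degenerate to cs(w_x+w_y)², leaves a zero in H^Λ (ED ≤ 16 sites: none).
sources: BorceaBranden2009, BorceaBrandenLiggett2007, Branden2007, arXiv:1210.3231, Tasaki2020
[crux] Theorem S of the card (hard-core form; the new theorem this line rests on — filed FIRST): for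
every finite connected graph G on Λ, every |Δ| ≤ 1, every field μ : Λ → ℝ and every magnetisation
sector M, a sector ground vector ψ (ψ in the S³_tot = M eigenspace, ψ ≠ 0, Hψ = E_min(sector)ψ) of H
= xxzHamiltonian 1 G (−1) Δ + Σ_x μ_x S³_x satisfies Σ_S ψ(1_S) Π_{x∈S} z_x ≠ 0 whenever all Im z_x
> 0 (occupied = spin up = Fin-index 0; by Perron–Frobenius on the token graph ψ is positive up to a
phase and unique, so this is real stability = strongly Rayleigh). Proof plan: each bond factor of
e^{−τH} is a stability preserver iff |Δ| ≤ 1 (BondSymbolRayleigh + BorceaBranden2009 Thm 1.1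
sufficiency, or a direct bi-affine half-plane lemma in the style of the tree's `asano_edge`), site
factors are positive scalings of variables, Lie–Trotter over bonds and sites, multivariate Hurwitz
along complex lines, e_N = Σ_{|S|=N} z^S is stable, ⟨ψ, 1⟩ > 0. [difficulty: L] -/
@[route_item "route-AtomisticToContinuum-BECStronglyRayleigh"]
def GroundStateStability : Prop :=
  ∀ (Λ : Type) [Fintype Λ] [DecidableEq Λ] (G : SimpleGraph Λ) [DecidableRel G.Adj], G.Connected → ∀ (Δ : ℝ) (μ : Λ → ℝ), |Δ| ≤ 1 → ∀ (M : ℝ) (ψ : Literature.MathematicalPhysics.QuantumLattice.TensorIndex Λ 2 → ℂ), ψ ∈ Literature.MathematicalPhysics.QuantumLattice.spinZSector 1 M → ψ ≠ 0 → (Literature.MathematicalPhysics.QuantumLattice.xxzHamiltonian 1 G (-1) Δ + ∑ x : Λ, ((μ x : ℝ) : ℂ) • Literature.MathematicalPhysics.QuantumLattice.siteSpin 1 x 2).mulVec ψ = ((Literature.MathematicalPhysics.QuantumLattice.lowestEnergyInSector 1 (Literature.MathematicalPhysics.QuantumLattice.xxzHamiltonian 1 G (-1) Δ + ∑ x : Λ,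 ((μ x : ℝ) : ℂ) • Literature.MathematicalPhysics.QuantumLattice.siteSpin 1 x 2) M : ℝ) : ℂ) • ψ → ∀ z : Λ → ℂ, (∀ x, 0 < (z x).im) → (∑ S : Finset Λ, ψ (fun x => if x ∈ S then 0 else 1) * ∏ x ∈ S, z x) ≠ 0

/-- item stmt-AtomisticToContinuum-9673 · crux · rank 3 · open · by planner
why it might fail: lattice BEC in disguise (E_ω[L³Φ_T] ≥ 1/f₀ always): a heavy upper tail of log r^T under ω, or loss of spatial self-averaging of Σ_x(r^T_x)^k at some filling ≤ ½, makes M = ∞; in d = 1 Theorem S holds yet M ≍ N^c; no tool beyond negative association of π so far.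
sources: ReattoChester1967, LSSY2005, BorceaBrandenLiggett2007, Toth1991, KLS1988PRL
[crux] card item K1, typed for d = 3, Δ = 0, all fillings ≤ ½: there is M such that for every L ≥ 2,
every 2 ≤ N ≤ L³/2 and every entrywise real-nonnegative sector-N ground vector ψ of xyTorus 3 L 1
(sector S³_tot = N − L³/2), with φ(S) = Re ψ(1_S) and r^T_x = Σ_y [x,y ∉ T, x ≠ y] φ(T∪{x,y}) for
|T| = N−2: L³ · Σ_T [ Σ_x (r^T_x)³ / Σ_x r^T_x + (Σ_x (r^T_x)²)² / (Σ_x r^T_x)² ] ≤ M · Σ_T Σ_x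
(r^T_x)² — the ω-average (ω_T ∝ ‖r^T‖²) of L³Φ_T is ≤ M (cross-multiplied, so Lean's x/0 = 0 matches
r^T ≡ 0). For a flat insertion field L³Φ_T = 2L³/(L³−N+2) ∈ [2,4]; for each fixed L the inequality
holds with M = 2L³ (r ≥ 0), so only the thermodynamic limit is at stake. [deps:
GroundStateStability] [difficulty: XL] -/
@[route_item "route-AtomisticToContinuum-BECStronglyRayleigh"]
def InsertionFieldDelocalisation : Prop :=
  ∃ M : ℝ, ∀ (L : ℕ) [NeZero L], 2 ≤ L → ∀ N : ℕ, 2 ≤ N → 2 * N ≤ L ^ 3 → ∀ ψ : Literature.MathematicalPhysics.QuantumLattice.TensorIndex (Literature.Probability.LatticeModels.TorusSite 3 L) 2 → ℂ, ψ ∈ Literature.MathematicalPhysics.QuantumLattice.spinZSector 1 ((N : ℝ) - (L : ℝ) ^ 3 / 2) → ψ ≠ 0 → (Literature.MathematicalPhysics.QuantumLattice.xyTorus 3 L 1).mulVec ψ = ((Literature.MathematicalPhysics.QuantumLattice.lowestEnergyInSector 1 (Literature.MathematicalPhysics.QuantumLattice.xyTorus 3 L 1) ((N : ℝ) - (L :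 ℝ) ^ 3 / 2) : ℝ) : ℂ) • ψ → (∀ σ, 0 ≤ (ψ σ).re ∧ (ψ σ).im = 0) → let φ : Finset (Literature.Probability.LatticeModels.TorusSite 3 L) → ℝ := fun S => (ψ (fun x => if x ∈ S then 0 else 1)).re; let r : Finset (Literature.Probability.LatticeModels.TorusSite 3 L) → Literature.Probability.LatticeModels.TorusSite 3 L → ℝ := fun T x => ∑ y, (if x ∉ T ∧ y ∉ T ∧ x ≠ y then φ (insert x (insert y T)) else 0); (L : ℝ) ^ 3 * ∑ T ∈ (Finset.univ : Finset (Literature.Probability.LatticeModels.TorusSite 3 L)).powersetCard (N - 2), ((∑ x, r T x ^ 3) / (∑ x, r T x) + (∑ x, r T x ^ 2) ^ 2 / (∑ x, r T x) ^ 2) ≤ M * ∑ T ∈ (Finset.univ : Finset (Literature.Probability.LatticeModels.TorusSite 3 L)).powersetCard (N - 2), ∑ x, r T x ^ 2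

/-- item stmt-AtomisticToContinuum-9674 · crux · rank 4 · open · by planner
why it might fail: a bare implication between two open statements — as hard as PeriodicBEC unless a comparison sign (condensate monotone in lattice depth) or a box-array reduction into Theorem S's soft-core class is found; universality of an ORDER PARAMETER (not an energy) across the tight-binding limit is unproved.
sources: AizenmanEtAl2004, LSSY2005, arXiv:2602.16566, Fournais2020, Junge2026
[crux] KineticLatticeBEC (uniform RP-free BEC of hard-core bosons on even 3-D tori at all fillings ≤
½, written out verbatim as antecedent — the shared signature of stmt-AtomisticToContinuum-5008)
implies PeriodicBEC: for every repulsive finite-range v there is ρ₀ > 0 such that for 0 < ρ < ρ₀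
there is c > 0 with, for all large N, some δ > 0 such that every δ-near-minimiser of the periodic
N-body energy on the torus of side (N/ρ)^{1/3} has constant-mode occupation ≥ cN. Intended
mechanisms (layer 2, not filed): (i) optical-lattice depth homotopy at fixed spacing b = 2R₀(v),
filling ν = ρb³ small, deep end = dilute hard-core lattice gas; (ii) a Josephson-array reduction —
condensates of Fournais/Junge boxes (proved in tree: Fournais2020_condensation) coupled through
faces form a soft-core Bose–Hubbard array, which is INSIDE Theorem S's class (hopping = nonnegative
substitution, U ≥ 0 a Pólya–Schur multiplier), so global coherence would again be Lorentz signature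
+ delocalisation one scale up. [deps: KineticLatticeBEC] [difficulty: open-problem] -/
@[route_item "route-AtomisticToContinuum-BECStronglyRayleigh", crux]
def LatticeToPeriodicBridge : Prop :=
  (∃ c : ℝ, 0 < c ∧ ∃ L₀ : ℕ, ∀ (L : ℕ) [NeZero L], L₀ ≤ L → Even L → ∀ N : ℕ, 1 ≤ N → 2 * N ≤ L ^ 3 → c * N * (L : ℝ) ^ 3 ≤ ((Literature.MathematicalPhysics.QuantumLattice.xyTorus 3 L 1 + (((3 + 1) * L ^ 3 : ℕ) : ℂ) • (Literature.MathematicalPhysics.QuantumLattice.totalSpin 1 2 + ((L : ℂ) ^ 3 / 2 - (N : ℂ)) • 1) ^ 2).groundStateFunctional (Literature.MathematicalPhysics.QuantumLattice.totalSpin 1 0 * Literature.MathematicalPhysics.QuantumLattice.totalSpin 1 0 + Literature.MathematicalPhysics.QuantumLattice.totalSpin 1 1 * Literature.MathematicalPhysics.QuantumLattice.totalSpin 1 1)).re + N - (L : ℝ) ^ 3 / 2) → ∀ v : ℝ → ENNReal, Literature.MathematicalPhysics.QuantumManyBody.BoseGas.IsRepulsiveFiniteRange v → ∃ ρ₀ :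 ℝ, 0 < ρ₀ ∧ ∀ ρ : ℝ, 0 < ρ → ρ < ρ₀ → ∃ c : ℝ, 0 < c ∧ ∀ᶠ N : ℕ in Filter.atTop, ∃ δ : ENNReal, 0 < δ ∧ ∀ Ψ : Literature.MathematicalPhysics.QuantumManyBody.BoseGas.PeriodicTrialState N (Literature.MathematicalPhysics.QuantumManyBody.BoseGas.sideLength ρ N), Literature.MathematicalPhysics.QuantumManyBody.BoseGas.periodicEnergy v Ψ ≤ Literature.MathematicalPhysics.QuantumManyBody.BoseGas.periodicGroundStateEnergy v N (Literature.MathematicalPhysics.QuantumManyBody.BoseGas.sideLength ρ N) + δ → ENNReal.ofReal (c * N) ≤ Literature.MathematicalPhysics.QuantumManyBody.BoseGas.condensateOccupation N (Literature.MathematicalPhysics.QuantumManyBody.BoseGas.sideLength ρ N) Ψ.ψ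

/-- item stmt-AtomisticToContinuum-0827 · crux · rank 5 · open · by planner
why it might fail: PeriodicBEC is ground-state-only at the box (N/ρ)^{1/3}; the Dirichlet ground state lies a wall term ≫ δ above E₀^per and interior restrictions are neither periodic nor of sharp N, so no energy-comparison proof; only the ENERGY transfer is in print; BEC can be BC-sensitive (Robinson1976).
sources: LSSY2005, Robinson1976, PenroseOnsager1956, Junge2026, BoccatoSeiringer2023
[crux] BoundaryTransferWeak (mode-free boundary-condition transfer, per potential): for each
repulsive finite-range v, PeriodicBEC(v) implies ∃ρ₀>0 ∀ρ∈(0,ρ₀) HasGroundStateBEC v ρ (Dirichlet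
ground state, λ_max(γ) ≥ cN via condensateNumber). Not glue: near-minimiser slacks are O(N/L²) while
Dirichlet/periodic energies differ by a boundary term ≫ N/L², so no energy-comparison proof;
expected route: Neumann bracketing of interior sub-boxes (−Δ_Dir ≥ ⊕−Δ_Neu, v ≥ 0) + a mode-free
criterion (λ_max ≥ tr γ²/N). Only the ENERGY analogue is in print (LiebSeiringerSolovejYngvason2005
Ch. 2 after (2.8)). v ≡ 0: hypothesis and conclusion both true. -/
@[route_item "route-AtomisticToContinuum-BECStronglyRayleigh", crux]
def BoundaryTransferWeak : Prop :=
  ∀ v : ℝ → ENNReal, Literature.MathematicalPhysics.QuantumManyBody.BoseGas.IsRepulsiveFiniteRange v → (∃ ρ₀ : ℝ, 0 < ρ₀ ∧ ∀ ρ : ℝ, 0 < ρ → ρ < ρ₀ → ∃ c : ℝ, 0 < c ∧ ∀ᶠ N : ℕ in Filter.atTop, ∃ δ : ENNReal, 0 < δ ∧ ∀ Ψ : Literature.MathematicalPhysics.QuantumManyBody.BoseGas.PeriodicTrialState N (Literature.MathematicalPhysics.QuantumManyBody.BoseGas.sideLength ρ N), Literature.MathematicalPhysics.QuantumManyBody.BoseGas.periodicEnergy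 v Ψ ≤ Literature.MathematicalPhysics.QuantumManyBody.BoseGas.periodicGroundStateEnergy v N (Literature.MathematicalPhysics.QuantumManyBody.BoseGas.sideLength ρ N) + δ → ENNReal.ofReal (c * N) ≤ Literature.MathematicalPhysics.QuantumManyBody.BoseGas.condensateOccupation N (Literature.MathematicalPhysics.QuantumManyBody.BoseGas.sideLength ρ N) Ψ.ψ) → ∃ ρ₀ : ℝ, 0 < ρ₀ ∧ ∀ ρ : ℝ, 0 < ρ → ρ < ρ₀ → Literature.MathematicalPhysics.QuantumManyBody.BoseGas.HasGroundStateBEC v ρ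

/-- item stmt-AtomisticToContinuum-9675 · support · rank 9 · closed · proved by Summit.AtomisticToContinuum.BoseEinsteinCondensation.Theorems.StableImpliesPairCoherence_proof (prover) · by planner
sources: BrandenHuh2019, BorceaBrandenLiggett2007, arXiv:1210.3231
[support] geometry-of-polynomials glue (BrandenHuh2019 Prop 1.2, Lemma 1.5; in fact elementary): for
a finite set Λ, N ≥ 2 and φ : Finset Λ → ℝ≥0 supported on N-sets whose generating polynomial Σ_S
φ(S) z^S has no zero in H^Λ, with r^T_x = Σ_y [x,y ∉ T, x ≠ y] φ(T∪{x,y}): N(N−1) Σ_S φ(S)² ≤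
Σ_{|T|=N−2} [ Σ_x (r^T_x)³/R_T + ‖r^T‖⁴/R_T² ]. Proof: ∂^T p = ½ zᵀK_T z is stable (derivatives and
Hurwitz) with K_T ≥ 0 and zero diagonal, hence Lorentzian: (1ᵀK_T v)² ≥ R_T · vᵀK_T v for real v
(reverse Cauchy–Schwarz); v = e_x + e_y gives K_T(x,y) ≤ (r_x+r_y)²/(2R_T), v = r gives rᵀK_T r ≤
‖r‖⁴/R_T; sum K_T² ≤ K_T(r_x+r_y)²/(2R_T) over x ≠ y and over T, using Σ_T‖K_T‖_F² = N(N−1)Σ_Sφ(S)²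
(x/0 = 0 matches K_T = 0). Checked by hand on Λ = {1,2,3}, N = 2, 3 (equality for z₁z₂z₃, 6 ≤ 8 for
e₂). [difficulty: M] -/
@[route_item "route-AtomisticToContinuum-BECStronglyRayleigh"]
def StableImpliesPairCoherence : Prop :=
  ∀ (Λ : Type) [Fintype Λ] [DecidableEq Λ] (N : ℕ), 2 ≤ N → ∀ φ : Finset Λ → ℝ, (∀ S, 0 ≤ φ S) → (∀ S, S.card ≠ N → φ S = 0) → (∀ z : Λ → ℂ, (∀ x, 0 < (z x).im) → (∑ S : Finset Λ, (φ S : ℂ) * ∏ x ∈ S, z x) ≠ 0) → let r : Finset Λ → Λ → ℝ := fun T x => ∑ y : Λ, (if x ∉ T ∧ y ∉ T ∧ x ≠ y then φ (insert x (insert y T)) else 0); (N : ℝ) * ((N : ℝ) - 1) * ∑ S : Finset Λ, φ S ^ 2 ≤ ∑ T ∈ (Finset.univ : Finset Λ).powersetCard (N - 2), ((∑ x, r T x ^ 3) / (∑ x, r T x) + (∑ x, r T x ^ 2) ^ 2 / (∑ x, r T x) ^ 2)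

/-- item stmt-AtomisticToContinuum-9676 · support · rank 9 · closed · proved by Summit.AtomisticToContinuum.BoseEinsteinCondensation.Theorems.PairKernelSumRule_proof (prover) · by planner
sources: PenroseOnsager1956, Toth1991
[support] the finite identity behind "n₀ = pair-insertion coherence": for φ supported on N-sets (N ≥
2) and r^T as above, Σ_{|T|=N−2} Σ_x (r^T_x)² = (N−1) Σ_{x,y} γ(x,y), where γ(x,x) = Σ_{S∋x} φ(S)²
and γ(x,y) = Σ_{|T'|=N−1, x,y∉T'} φ(T'∪{x}) φ(T'∪{y}) for x ≠ y (= ⟨ψ, S⁺_x S⁻_y ψ⟩ for the spin-½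
vector ψ(1_S) = φ(S)); pure double counting ((T,x) ↦ T∪{x} is (N−1)-to-1). Checked by hand on Λ =
{1,2,3}, N = 2 (12 = 12). [difficulty: provable-now] -/
@[route_item "route-AtomisticToContinuum-BECStronglyRayleigh"]
def PairKernelSumRule : Prop :=
  ∀ (Λ : Type) [Fintype Λ] [DecidableEq Λ] (N : ℕ), 2 ≤ N → ∀ φ : Finset Λ → ℝ, (∀ S, S.card ≠ N → φ S = 0) → let r : Finset Λ → Λ → ℝ := fun T x => ∑ y : Λ, (if x ∉ T ∧ y ∉ T ∧ x ≠ y then φ (insert x (insert y T)) else 0); ∑ T ∈ (Finset.univ : Finset Λ).powersetCard (N - 2), ∑ x, r T x ^ 2 = ((N : ℝ) - 1) * ∑ x : Λ, ∑ y : Λ, (if x = y then ∑ S : Finset Λ, (if x ∈ S then φ S ^ 2 else 0) else ∑ T ∈ (Finset.univ : Finset Λ).powersetCard (N - 1), (if x ∉ T ∧ y ∉ T then φ (insert x T) * φ (insert y T) else 0))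

/-- item stmt-AtomisticToContinuum-9677 · support · rank 9 · closed · proved by Summit.AtomisticToContinuum.BoseEinsteinCondensation.Theorems.SectorGroundStatePerron_proof (prover) · by planner
sources: Tasaki2020, KLS1988PRL, doi:10.1007/s00373-011-1055-9
[support] Perron–Frobenius in a magnetisation sector of the XY torus: for d ≥ 1, L ≥ 2 and N ≤ L^d
the sector S³_tot = N − L^d/2 of xyTorus d L 1 contains a nonzero, entrywise real-nonnegative vector
ψ with Hψ = E_min(sector)ψ, and every sector vector with that eigenvalue is a complex multiple of ψ
(off-diagonal matrix elements −½ ≤ 0; the N-token graph of the connected torus graph is connected —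
tree `TokenSliding.exists_slide_out`, `perronFrobenius_groundState_pos/unique`). [difficulty:
provable-now] -/
@[route_item "route-AtomisticToContinuum-BECStronglyRayleigh"]
def SectorGroundStatePerron : Prop :=
  ∀ (d L : ℕ) [NeZero L], 1 ≤ d → 2 ≤ L → ∀ N : ℕ, N ≤ L ^ d → ∃ ψ : Literature.MathematicalPhysics.QuantumLattice.TensorIndex (Literature.Probability.LatticeModels.TorusSite d L) 2 → ℂ, ψ ≠ 0 ∧ (∀ σ, 0 ≤ (ψ σ).re ∧ (ψ σ).im = 0) ∧ ψ ∈ Literature.MathematicalPhysics.QuantumLattice.spinZSector 1 ((N : ℝ) - (L : ℝ) ^ d / 2) ∧ (Literature.MathematicalPhysics.QuantumLattice.xyTorus d L 1).mulVec ψ = ((Literature.MathematicalPhysics.QuantumLattice.lowestEnergyInSector 1 (Literature.MathematicalPhysics.QuantumLattice.xyTorus d L 1) ((N : ℝ) - (L : ℝ) ^ d / 2) : ℝ) : ℂ) • ψ ∧ ∀ ψ' : Literature.MathematicalPhysics.QuantumLattice.TensorIndex (Literature.Probability.LatticeModels.TorusSite d L) 2 → ℂ, ψ' ∈ Literature.MathematicalPhysics.QuantumLattice.spinZSector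 1 ((N : ℝ) - (L : ℝ) ^ d / 2) → (Literature.MathematicalPhysics.QuantumLattice.xyTorus d L 1).mulVec ψ' = ((Literature.MathematicalPhysics.QuantumLattice.lowestEnergyInSector 1 (Literature.MathematicalPhysics.QuantumLattice.xyTorus d L 1) ((N : ℝ) - (L : ℝ) ^ d / 2) : ℝ) : ℂ) • ψ' → ∃ c : ℂ, ψ' = c • ψ

/-- item stmt-AtomisticToContinuum-9678 · support · rank 9 · closed · proved by Summit.AtomisticToContinuum.BoseEinsteinCondensation.Theorems.PenaltySelectsSector_proof (prover) · by planner
sources: Tasaki2020, KLS1988PRL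
[support] shared item stmt-AtomisticToContinuum-5011, verbatim (the encoding lemma linking sector
ground vectors to the target's penalised Hamiltonian): for d ≥ 1, L ≥ 1, N ≤ L^d every ground vector
of xyTorus d L 1 + (d+1)L^d·(S³_tot + (L^d/2 − N)·1)² lies in the sector of N bosons (the penalty
(d+1)L^d exceeds the spectral width ≤ 2‖H‖ ≤ d·L^d of the XY Hamiltonian, each bond S¹S¹+S²S² having
norm ½, and the sector is non-empty). [difficulty: provable-now] -/
@[route_item "route-AtomisticToContinuum-BECStronglyRayleigh"]
def PenaltySelectsSector : Prop :=
  ∀ (d L : ℕ) [NeZero L] (N : ℕ), 1 ≤ d → N ≤ L ^ d → ∀ ψ : Literature.MathematicalPhysics.QuantumLattice.TensorIndex (Literature.Probability.LatticeModels.TorusSite d L) 2 → ℂ, ψ ∈ (Literature.MathematicalPhysics.QuantumLattice.xyTorus d L 1 + (((d + 1) * L ^ d : ℕ) : ℂ) • (Literature.MathematicalPhysics.QuantumLattice.totalSpin 1 2 + ((L : ℂ) ^ d / 2 - (N : ℂ)) • 1) ^ 2).groundSpace → (Literature.MathematicalPhysics.QuantumLattice.totalSpin (Λ := Literature.Probability.LatticeModels.TorusSite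 d L) 1 2 + ((L : ℂ) ^ d / 2 - (N : ℂ)) • 1).mulVec ψ = 0

/-- item stmt-AtomisticToContinuum-9679 · support · rank 9 · closed · proved by Summit.AtomisticToContinuum.BoseEinsteinCondensation.Theorems.bondSymbolRayleigh_proof (prover) · by planner
sources: Branden2007, BorceaBranden2009, BorceaBrandenLiggett2007
[support] the cheapest falsifier, formalised: for t > 0 (= Jτ) and κ > 0 (= e^{−Vτ}), the three
Brändén–Rayleigh differences of the bond symbol — cosh t·sinh t(a²+b²) + (cosh²t + sinh²t − κ)ab, κ
cosh t·a² + (κ+1)ab + cosh t·b², κ sinh t·a² + (κ−1)ab + sinh t·b² — are all nonnegative on ℝ² iff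
e^{−2t} ≤ κ ≤ e^{2t} (⟺ |V| ≤ 2J, "bondwise kinetic domination"; discriminants: (c−s)² ≤ κ ≤ (c+s)²,
cosh t ≥ cosh(½log κ), sinh t ≥ |sinh(½log κ)| — each of the three alone already pins the same
window). [difficulty: provable-now] -/
@[route_item "route-AtomisticToContinuum-BECStronglyRayleigh"]
def BondSymbolRayleigh : Prop :=
  ∀ t κ : ℝ, 0 < t → 0 < κ → (((∀ a b : ℝ, 0 ≤ Real.cosh t * Real.sinh t * (a ^ 2 + b ^ 2) + (Real.cosh t ^ 2 + Real.sinh t ^ 2 - κ) * a * b) ∧ (∀ a b : ℝ, 0 ≤ κ * Real.cosh t * a ^ 2 + (κ + 1) * a * b + Real.cosh t * b ^ 2) ∧ (∀ a b : ℝ, 0 ≤ κ * Real.sinh t * a ^ 2 + (κ - 1) * a * b + Real.sinh t * b ^ 2)) ↔ (Real.exp (-(2 * t)) ≤ κ ∧ κ ≤ Real.exp (2 * t)))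

/-- item stmt-AtomisticToContinuum-9680 · support · rank 9 · closed · proved by Summit.AtomisticToContinuum.BoseEinsteinCondensation.Theorems.LatticeCoherenceAssembly_proof (prover) · by planner
sources: LSSY2005, BrandenHuh2019, Tasaki2020
[support] the layer-2 glue (finite-dimensional, est. 600–1000 lines, provable now from its
antecedents): GroundStateStability → StableImpliesPairCoherence → InsertionFieldDelocalisation →
PairKernelSumRule → SectorGroundStatePerron → PenaltySelectsSector → KineticLatticeBEC. Proof: for L
≥ 2 and 2 ≤ N ≤ L³/2 take the Perron vector ψ of the sector (SectorGroundStatePerron);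
GroundStateStability with G = torusGraph 3 L, Δ = 0, μ = 0 (the field sum vanishes by `simp`) gives
zero-freeness of Σ_S φ(S) z^S, φ = Re ψ(1_·) ≥ 0 supported on N-sets; StableImpliesPairCoherence and
InsertionFieldDelocalisation give N(N−1)L³Σφ² ≤ L³Σ_T‖r^T‖²Φ_T ≤ M Σ_T‖r^T‖² = M(N−1)Σ_{x,y}γ(x,y)
(PairKernelSumRule), and Σ_{x,y}γ(x,y) = ⟨ψ, S⁺_totS⁻_tot ψ⟩ (spin-½ matrix elements of S⁺_xS⁻_y are
1), so ⟨S⁺_totS⁻_tot⟩_ψ ≥ N·L³‖ψ‖²/max(M,1); PenaltySelectsSector + uniqueness identify the ground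
space of the penalised Hamiltonian with ℂψ, whose groundStateFunctional is the pure state of ψ, and
⟨S⁺_totS⁻_tot⟩ = ⟨(S¹_tot)²+(S²_tot)²⟩ + ⟨S³_tot⟩ with S³_tot = N − L³/2; N = 1 is one free particle
(⟨S⁺_totS⁻_tot⟩ = L³). Hence KineticLatticeBEC with c = min(1, 1/max(M,1)), L₀ = 2. [difficulty: L] -/
@[route_item "route-AtomisticToContinuum-BECStronglyRayleigh"]
def LatticeCoherenceAssembly : Prop :=
  GroundStateStability → StableImpliesPairCoherence → InsertionFieldDelocalisation → PairKernelSumRule → SectorGroundStatePerron → PenaltySelectsSector → KineticLatticeBEC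

-- earlier Assembly (stmt-AtomisticToContinuum-9681, replaced 2026-08-15T21:15:39Z -> stmt-AtomisticToContinuum-13783): retired by None — KineticLatticeBEC → LatticeToPeriodicBridge → BoundaryTransferWeak → _root_.BoseEinsteinCondensation
/-- item stmt-AtomisticToContinuum-13783 · assembly · rank 1 · closed · proved by Summit.AtomisticToContinuum.BoseEinsteinCondensation.Theorems.becStronglyRayleigh_assembly_proof @ 600e673676c9 (prover) · by planner
sources: LSSY2005, BorceaBrandenLiggett2007, BrandenHuh2019
[assembly] the thesis frame statement X → Statement with X = the four ranked cruxes: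
GroundStateStability → InsertionFieldDelocalisation → LatticeToPeriodicBridge → BoundaryTransferWeak
→ BoseEinsteinCondensation (the conjunct). Not logic: cruxes 2–3 reach the target KineticLatticeBEC
only through the provable supports StableImpliesPairCoherence, PairKernelSumRule,
SectorGroundStatePerron, PenaltySelectsSector and the layer-2 glue LatticeCoherenceAssembly; the
proved deciding theorem `closes` (KineticLatticeBEC → LatticeToPeriodicBridge → BoundaryTransferWeak
→ Statement) finishes: Assembly = fun hS hI hB hW => closes (LatticeCoherenceAssembly hS h₁ hI h₂ h₃
h₄) hB hW given the supports h₁…h₄ (checked in the planner's Sketch.lean). Restated 2026-08-15 from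
the curried form KineticLatticeBEC → LatticeToPeriodicBridge → BoundaryTransferWeak →
BoseEinsteinCondensation, which coincides with `closes` and is closed by `tauto` (ground.trivial). -/
@[route_item "route-AtomisticToContinuum-BECStronglyRayleigh"]
def Assembly : Prop :=
  GroundStateStability → InsertionFieldDelocalisation → LatticeToPeriodicBridge → BoundaryTransferWeak → _root_.BoseEinsteinCondensation

/-! D-0027 §2.1 — DECIDING THEOREM (planner-authored via `route open/edit --closes-file`; by planner-rrepair-AtomisticToContinuum-BECStrong-59c85534-g4-0 2026-08-15T18:06:22Z):
its hypotheses are this route's items and its conclusion the sub-problem Statement (glue_lint), and it elaborates with this file. -/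

@[closes "route-AtomisticToContinuum-BECStronglyRayleigh"] theorem closes (hK : KineticLatticeBEC) (hB : LatticeToPeriodicBridge) (hW : BoundaryTransferWeak) :
    _root_.BoseEinsteinCondensation :=
  -- layer 1 (pure logic): torus BEC from the lattice target via the bridge, then the b.c. transfer (cone repair g4, native re-certification attempt 4)
  fun v hv => hW v hv (hB hK v hv)

end Summit.AtomisticToContinuum.BoseEinsteinCondensation.Theses.BECStronglyRayleigh
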